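import Summits.Ventures.PercRepro2.CaseOnePocketForms

/-!
# The mark `o` pendant at the root `a₁`: every statement vertex is closed
(blind cell PercRepro2, p1 g27; a degenerate class that the pocket reduction makes infinite)

If the mark `o` is a leaf at the root `a₁` (`IsLeafAt ends a₁ o e₀`, `o ≠ a₂`), then under
`Q = {a₁ ↮ a₂}` the event `{o ∈ C₂}` is empty — a path from `a₂` to `o` enters `o` through its only
edge, from `a₁`. Every `o ∈ C₂`-mass of the case-1 forms vanishes and the forms collapse to BHK:
`(ii-t)` to `c₀ · [P(Q, b ∈ C₂) P(Q, a₃ ∈ C₁) − P(Q) P(Q, b ∈ C₂, a₃ ∈ C₁)] ≥ 0` (cross-cluster,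
`bhk_cross_cluster`) and `(i-t)` to `c₀ · [P(Q) P(Q, b ∈ C₁, a₃ ∈ C₁) − P(Q, b ∈ C₁) P(Q, a₃ ∈ C₁)] ≥ 0`
(same-cluster, `bhk_same_cluster_events`), at every pair with `c₀ ≥ 0`; at the PD pair and at the Q
pair this is the four forms at EVERY statement vertex `a₃` (**`closedAt_of_o_leaf_root`**). With the
pocket reduction (`closedAt_of_pocket'` with the designated vertex `z = o`) the class becomes infinite:
**`closedAt_of_o_pocket_root`** — the mark `o` in a mark-free-otherwise pocket hanging at the root
`a₁`, the statement vertex anywhere outside. Own code; standard axioms. -/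

namespace Summit.Ventures.PercRepro2

namespace CaseOne

section OLeaf
variable {V : Type*} {E : Type*} [Fintype E] [DecidableEq E] [Fintype V] [DecidableEq V]
  {R : Type*} [CommRing R] [LinearOrder R] [IsStrictOrderedRing R]
variable {ends : E → Sym2 V} {o a₁ a₂ : V} {e₀ : E}

omit [Fintype E] [DecidableEq E] [Fintype V] [DecidableEq V] in
/-- A vertex other than `o` connected to the leaf `o` is connected to its neighbour `a₁`. -/
lemma conn_a1_of_conn_leaf (hl : IsLeafAt ends a₁ o e₀) (ω : Config E) {u : V} (hu : u ≠ o)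
    (h : Conn ends ω u o) : Conn ends ω u a₁ := by
  by_cases he : ω e₀ = true
  · exact conn_trans h (conn_symm (conn_of_openAdj ⟨e₀, he, hl.ends_eq⟩))
  · have hω : ω e₀ = false := by simpa using he
    exact absurd (eq_of_conn_leaf_of_closed hl hω (conn_symm h)) hu

omit [Fintype E] [DecidableEq E] [Fintype V] [DecidableEq V] in
/-- **Under `Q` the mark `o` is never in `C₂`** when it is a leaf at `a₁`. -/
lemma connEvent_a2_o_inter_Q_eq_empty (hl : IsLeafAt ends a₁ o e₀) (h2 : o ≠ a₂) :
    connEvent ends a₂ o ∩ (connEvent ends a₁ a₂)ᶜ = ∅ := by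
  ext ω
  simp only [Set.mem_inter_iff, mem_connEvent, Set.mem_compl_iff, Set.mem_empty_iff_false,
    iff_false, not_and, not_not]
  intro h
  exact conn_symm (conn_a1_of_conn_leaf hl ω h2.symm h)

omit [Fintype V] [DecidableEq V] [LinearOrder R] [IsStrictOrderedRing R] in
/-- Every event inside `{o ∈ C₂} ∩ Q` has probability zero. -/
lemma prob_eq_zero_of_subset_o_leaf (p : E → R) (hl : IsLeafAt ends a₁ o e₀)
    (h2 : o ≠ a₂) {X : Set (Config E)} (hX : X ⊆ connEvent ends a₂ o ∩ (connEvent ends a₁ a₂)ᶜ) :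
    prob p X = 0 := by
  rw [connEvent_a2_o_inter_Q_eq_empty hl h2, Set.subset_empty_iff] at hX
  rw [hX, prob_empty]

/-- **`(ii-t)` for `o` a leaf at `a₁`**, at every pair with `c₀ ≥ 0`: BHK 1.4 between `{b ∈ C₂}` and
`{a₃ ∈ C₁}`. -/
theorem iiExprT_nonneg_of_o_leaf {p : E → R} (hp : IsProbVec p) (hl : IsLeafAt ends a₁ o e₀)
    (h2 : o ≠ a₂) (a₃ b : V) (c₀ c₁ : R) (hc₀ : 0 ≤ c₀) : 0 ≤ iiExprT p ends o a₁ a₂ a₃ b c₀ c₁ := by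
  rw [iiExprT_eq]
  rw [prob_eq_zero_of_subset_o_leaf p hl h2 (X := connEvent ends a₂ b ∩ connEvent ends a₁ a₃ ∩
      connEvent ends a₂ o ∩ (connEvent ends a₁ a₂)ᶜ) (fun _ h => ⟨h.1.2, h.2⟩),
    prob_eq_zero_of_subset_o_leaf p hl h2 (X := connEvent ends a₁ a₃ ∩ connEvent ends a₂ o ∩
      (connEvent ends a₁ a₂)ᶜ) (fun _ h => ⟨h.1.2, h.2⟩)]
  have hbhk := bhk_cross_cluster p hp ends a₂ a₁ (isUpperSet_mem_setOf b) (isUpperSet_mem_setOf a₃)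
  rw [← connEvent_eq_clusterInEvent ends a₂ b, ← connEvent_eq_clusterInEvent ends a₁ a₃,
    connEvent_comm ends a₂ a₁] at hbhk
  have := mul_nonneg hc₀ (sub_nonneg.mpr hbhk)
  linear_combination this

/-- **`(i-t)` for `o` a leaf at `a₁`**, at every pair with `c₀ ≥ 0`: BHK 1.3 for `{b ∈ C₁}` and
`{a₃ ∈ C₁}`. -/
theorem iExprT_nonneg_of_o_leaf {p : E → R} (hp : IsProbVec p) (hl : IsLeafAt ends a₁ o e₀)
    (h2 : o ≠ a₂) (a₃ b : V) (c₀ c₁ : R) (hc₀ : 0 ≤ c₀) : 0 ≤ iExprT p ends o a₁ a₂ a₃ b c₀ c₁ := by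
  rw [iExprT_eq]
  rw [prob_eq_zero_of_subset_o_leaf p hl h2 (X := connEvent ends a₁ b ∩ connEvent ends a₁ a₃ ∩
      connEvent ends a₂ o ∩ (connEvent ends a₁ a₂)ᶜ) (fun _ h => ⟨h.1.2, h.2⟩),
    prob_eq_zero_of_subset_o_leaf p hl h2 (X := connEvent ends a₁ a₃ ∩ connEvent ends a₂ o ∩
      (connEvent ends a₁ a₂)ᶜ) (fun _ h => ⟨h.1.2, h.2⟩)]
  have hbhk := bhk_same_cluster_events p hp ends a₁ a₂ (isUpperSet_mem_setOf b)
    (isUpperSet_mem_setOf a₃)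
  rw [← connEvent_eq_clusterInEvent ends a₁ b, ← connEvent_eq_clusterInEvent ends a₁ a₃] at hbhk
  have := mul_nonneg hc₀ (sub_nonneg.mpr hbhk)
  linear_combination this

/-- **The four case-1 forms at EVERY statement vertex when `o` is a leaf at `a₁`.** -/
theorem fourForms_of_o_leaf {p : E → R} (hp : IsProbVec p) (hl : IsLeafAt ends a₁ o e₀) (h2 : o ≠ a₂)
    (a₃ b : V) : FourForms p ends o a₁ a₂ a₃ b := by
  have hD : 0 ≤ Dpdo p ends o a₁ a₂ a₃ := prob_nonneg hp _
  have hQ : 0 ≤ Dqo p ends o a₁ a₂ := prob_nonneg hp _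
  refine ⟨?_, ?_, ?_, ?_⟩
  · unfold ZSplitII
    rw [iiExpr_eq_iiExprT]
    exact iiExprT_nonneg_of_o_leaf hp hl h2 a₃ b _ _ hD
  · exact iiExprT_nonneg_of_o_leaf hp hl h2 a₃ b _ _ hQ
  · unfold ZSplitI
    rw [iExpr_eq_iExprT]
    exact iExprT_nonneg_of_o_leaf hp hl h2 a₃ b _ _ hD
  · exact iExprT_nonneg_of_o_leaf hp hl h2 a₃ b _ _ hQ

/-- **`o` a leaf at the root `a₁`: every statement vertex is closed.** -/
theorem closedAt_of_o_leaf_root (hl : IsLeafAt ends a₁ o e₀) (h2 : o ≠ a₂) (a₃ b : V) :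
    ClosedAt R o a₁ a₂ b E ends a₃ :=
  fun _ hp => fourForms_of_o_leaf hp hl h2 a₃ b

end OLeaf

section OPocket
variable {V : Type*} {E : Type*} [Fintype E] [DecidableEq E] [Fintype V] [DecidableEq V]
  {R : Type*} [CommRing R] [LinearOrder R] [IsStrictOrderedRing R]
variable {ends : E → Sym2 V} {W : Set V} {P : Finset E} {e₀ : E} {o a₁ a₂ a₃ b : V}

/-- **The mark `o` in a mark-free-otherwise pocket hanging at the root `a₁`**: every statement vertex
outside the pocket is closed (the pocket is the pendant edge `{a₁, o}` for the four forms, and a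
pendant `o` at `a₁` is closed). -/
theorem closedAt_of_o_pocket_root (h : IsPocket ends W a₁ P) (he : e₀ ∈ P) (ho : o ∈ W)
    (h2 : a₂ ∉ W) (ha : a₃ ∉ W) (hb : b ∉ W) : ClosedAt R o a₁ a₂ b E ends a₃ :=
  closedAt_of_pocket' (z := o) h he (Or.inr rfl) (Or.inl h.x_not_mem) (Or.inl h2) (Or.inl ha)
    (Or.inl hb)
    (closedAt_of_o_leaf_root (h.isLeafAt_pocketEnds e₀ ho) (by rintro rfl; exact h2 ho) a₃ b)

end OPocket

end CaseOne

end Summit.Ventures.PercRepro2
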